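import Mathlib
import HarnessLib
import Summits.HubbardSuperconductivity.HubbardSuperconductivity.Theorems.KLProgrammeKLRegimeVolumeLimitCutoffRemoval
import Summits.HubbardSuperconductivity.HubbardSuperconductivity.Theorems.KLProgrammeKLRegimeVolumeLimitCauchyMatsubara

/-!
# Child `KLRegimeVolumeLimitV12` (stmt-HubbardSuperconductivity-19858) — the CUTOFF-FREE DOORS: both registered stubs of the VL skeleton
# «cauchy» follow VERBATIM from statements about the cutoff-free (`M = ∞`) carrier `klSelfEnergyInf` (seat hubbard-kl-k3c5-p3 g4,
# technique «OS-positivity-free direct assembly»)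

With the label-uniform Matsubara-cutoff removal `klSelfEnergy_cutoffLimit_labelUniform` (`…VolumeLimitCutoffRemoval`, every coupling / frame /
spin) the Matsubara threshold `Mth L` of both stubs is DISCHARGED once and for all; what the VL child still owes are VOLUME statements about the
cutoff-free objects of `…VolumeLimitCutoffFreeDefs`:

* **`stub_vl_twoVolumeRate_of_cutoffFreeRate`** — the registered Cauchy stub `stub_vl_twoVolumeRate` VERBATIM from the SAME text with its
  conclusion replaced by a two-volume rate of the cutoff-free carrier,
  `∃ L₀ D ρ, ρ → 0 ∧ ∀ L₀ ≤ L ≤ L′ ∀ n k k′, ‖Σ∞^K_L(n,k) − Σ∞^K_{L′}(n,k′)‖ ≤ ρ L + D·Σ_i |p_k i − p′_{k′} i|_𝕋`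
  (k3c4-p1's split `twoVolumeRate_of_matsubaraLimit` with `hcut := klSelfEnergy_hcut`); `…_allU` the regime-free variant;
* **`stub_vl_bound_of_cutoffFreeBound`** — the registered `stub_vl_bound` VERBATIM from the same text with its conclusion replaced by
  `∃ B L₀, ∀ L ≥ L₀ ∀ n p, ‖Σ∞^K_L(n,p)‖ ≤ B`; and **`stub_vl_bound_of_sixInf_bound`** — from ONE `L`-uniform bound on the bare six-point
  coefficient `Six∞_L(n,p)` for every `β > 0`, `U`, `μ` (`‖occ∞‖ ≤ 3/2` is free; frames by the door `stub_vl_bound_of_bareFrameBound`).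
So after this file the VL child `KLRegimeVolumeLimitV12` = [an `L`-uniform bound on `Six∞_L(n,p)` (⟸ (H1)+(P3) of the k3c5 lane, or the engine)]
+ [a two-volume rate of `Σ∞^K_L` (the engine's export; `…VolumeLimitCutoffFrame` reduces it further to the bare pieces)].  Everything is proved;
no definition.
-/

noncomputable section

namespace Summit.HubbardSuperconductivity.HubbardSuperconductivity.Theorems.TwoPointAssembly

set_option linter.dupNamespace false -- summit = problem name (single-conjunct summit), D-0017

open Finset Filter Topology Literature.MathematicalPhysics.QuantumLattice Literature.Probability.LatticeModels GrassmannAlgebra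
open Summit.HubbardSuperconductivity.HubbardSuperconductivity.Theorems.KLRegimeSplit
open Summit.HubbardSuperconductivity.HubbardSuperconductivity.Theorems.KLProgrammeLegKernels

/-! ## §1 The Cauchy stub from a two-volume rate of the cutoff-free carrier -/

/-- **At one regime point**: a two-volume rate of `Σ∞^K_L` beyond `L₀` gives the registered two-volume inequality for the finite-cutoff carrier
beyond `(max L₀ 3, Mth)` for a suitable Matsubara threshold `Mth` (every `U`, `β > 0`). -/
theorem twoVolumeRate_of_cutoffFreeRate {β : ℝ} (hβ : 0 < β) (U μ : ℝ) (K : TrigPolyC4v) {L₀ : ℕ} {D : ℝ} {ρ : ℕ → ℝ}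
    (hρ : Tendsto ρ atTop (𝓝 0))
    (hvol : ∀ (L : ℕ) [NeZero L], L₀ ≤ L → ∀ (L' : ℕ) [NeZero L'], L ≤ L' →
      ∀ (n : ℤ) (k : TorusSite 2 L) (k' : TorusSite 2 L'),
        ‖klSelfEnergyInf L β U μ K n k - klSelfEnergyInf L' β U μ K n k'‖ ≤
          ρ L + D * ∑ i, torusAbs (latticeMomentum L k i - latticeMomentum L' k' i)) :
    ∃ L₁ : ℕ, ∃ Mth : ℕ → ℕ, ∃ D' : ℝ, ∃ ρ' : ℕ → ℝ, Tendsto ρ' atTop (𝓝 0) ∧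
      ∀ (L : ℕ) [NeZero L], L₁ ≤ L → ∀ (M : ℕ) [NeZero M], Mth L ≤ M →
        ∀ (L' : ℕ) [NeZero L'], L ≤ L' → ∀ (M' : ℕ) [NeZero M'], Mth L' ≤ M' →
          ∀ (σ : Fin 2) (ω : MatsubaraIdx M) (ω' : MatsubaraIdx M'), matsubaraInt M ω = matsubaraInt M' ω' →
            ∀ (k : TorusSite 2 L) (k' : TorusSite 2 L'),
              ‖klSelfEnergy L M β U μ K klE0 (nScales β + 1) (ω, k) σ - klSelfEnergy L' M' β U μ K klE0 (nScales β + 1) (ω', k') σ‖ ≤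
                ρ' L + D' * ∑ i, torusAbs (latticeMomentum L k i - latticeMomentum L' k' i) := by
  have hcut := klSelfEnergy_hcut hβ U μ K
  obtain ⟨Mth, ρ', hρ', h⟩ := twoVolumeRate_of_matsubaraLimit
    (S := fun L M _ _ k σ => klSelfEnergy L M β U μ K klE0 (nScales β + 1) k σ)
    (Sinf := fun L _ n k _ => klSelfEnergyInf L β U μ K n k) (L₀ := max L₀ 3) (D := D) hρ
    (fun L _ hL ε hε => hcut L ((le_max_right _ _).trans hL) ε hε)
    (fun L _ hL L' _ hLL' n _ k k' => hvol L ((le_max_left _ _).trans hL) L' hLL' n k k')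
  exact ⟨max L₀ 3, Mth, D, ρ', hρ', h⟩

/-- **THE DOOR FOR `stub_vl_twoVolumeRate` OF `KLRegimeVolumeLimitV12`.**  IF, for every datum of the registered stub (constant records,
regime point, admissible frame, tower), the CUTOFF-FREE carrier has a two-volume rate
`∃ L₀ D ρ, ρ → 0 ∧ ∀ L₀ ≤ L ≤ L′ ∀ n k k′, ‖klSelfEnergyInf L β U μ K n k − klSelfEnergyInf L′ β U μ K n k′‖ ≤ ρ L + D·Σ_i |p_k i − p′_{k′} i|_𝕋`,
THEN the registered Cauchy stub holds verbatim. -/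
theorem stub_vl_twoVolumeRate_of_cutoffFreeRate
    (hvol : ∀ (G : GeoConsts) (P : SplitConsts) (Q : EngConsts) (R : RenConsts), G.WF → P.WF → Q.WF → R.WF →
      ∃ c₅ : ℝ, 0 < c₅ ∧ ∀ c : ℝ, 0 < c → c ≤ c₅ → ∃ U₀ : ℝ, 0 < U₀ ∧
        ∀ μ ∈ klWindowC, ∀ U : ℝ, 0 < U → U ≤ U₀ → ∀ β : ℝ, klBetaMin ≤ β → β ≤ Real.exp (c / U ^ 2) →
          ∀ K : TrigPolyC4v, klPredsV12.frameOK R U (nScales β) μ K →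
            ∀ (Lstar : ℕ) (Mstar : ℕ → ℕ), TowerP klPredsV12 G P Q R β U μ K Lstar Mstar →
              ∃ L₀ : ℕ, ∃ D : ℝ, ∃ ρ : ℕ → ℝ, Tendsto ρ atTop (𝓝 0) ∧
                ∀ (L : ℕ) [NeZero L], L₀ ≤ L → ∀ (L' : ℕ) [NeZero L'], L ≤ L' →
                  ∀ (n : ℤ) (k : TorusSite 2 L) (k' : TorusSite 2 L'),
                    ‖klSelfEnergyInf L β U μ K n k - klSelfEnergyInf L' β U μ K n k'‖ ≤
                      ρ L + D * ∑ i, torusAbs (latticeMomentum L k i - latticeMomentum L' k' i)) :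
    ∀ (G : GeoConsts) (P : SplitConsts) (Q : EngConsts) (R : RenConsts), G.WF → P.WF → Q.WF → R.WF →
      ∃ c₅ : ℝ, 0 < c₅ ∧ ∀ c : ℝ, 0 < c → c ≤ c₅ → ∃ U₀ : ℝ, 0 < U₀ ∧
        ∀ μ ∈ klWindowC, ∀ U : ℝ, 0 < U → U ≤ U₀ → ∀ β : ℝ, klBetaMin ≤ β → β ≤ Real.exp (c / U ^ 2) →
          ∀ K : TrigPolyC4v, klPredsV12.frameOK R U (nScales β) μ K →
            ∀ (Lstar : ℕ) (Mstar : ℕ → ℕ), TowerP klPredsV12 G P Q R β U μ K Lstar Mstar →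
              ∃ L₀ : ℕ, ∃ Mth : ℕ → ℕ, ∃ D : ℝ, ∃ ρ : ℕ → ℝ, Tendsto ρ atTop (𝓝 0) ∧
                ∀ (L : ℕ) [NeZero L], L₀ ≤ L → ∀ (M : ℕ) [NeZero M], Mth L ≤ M →
                  ∀ (L' : ℕ) [NeZero L'], L ≤ L' → ∀ (M' : ℕ) [NeZero M'], Mth L' ≤ M' →
                    ∀ (σ : Fin 2) (ω : MatsubaraIdx M) (ω' : MatsubaraIdx M'), matsubaraInt M ω = matsubaraInt M' ω' →
                      ∀ (k : TorusSite 2 L) (k' : TorusSite 2 L'),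
                        ‖klSelfEnergy L M β U μ K klE0 (nScales β + 1) (ω, k) σ -
                            klSelfEnergy L' M' β U μ K klE0 (nScales β + 1) (ω', k') σ‖ ≤
                          ρ L + D * ∑ i, torusAbs (latticeMomentum L k i - latticeMomentum L' k' i) := by
  intro G P Q R hG hP hQ hR
  obtain ⟨c₅, hc₅, hc⟩ := hvol G P Q R hG hP hQ hR
  refine ⟨c₅, hc₅, fun c hc0 hcc => ?_⟩
  obtain ⟨U₀, hU₀, hU⟩ := hc c hc0 hcc
  refine ⟨U₀, hU₀, fun μ hμ U hU0 hUU β hβmin hβmax K hK Lstar Mstar hT => ?_⟩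
  have hβ : 0 < β := pos_of_klBetaMin_le hβmin
  obtain ⟨L₀, D, ρ, hρ, hv⟩ := hU μ hμ U hU0 hUU β hβmin hβmax K hK Lstar Mstar hT
  exact twoVolumeRate_of_cutoffFreeRate hβ U μ K hρ hv

/-- **Regime-free variant**: a two-volume rate of `klSelfEnergyInf` for every `β > 0`, `U`, `μ`, `K` gives the registered Cauchy stub. -/
theorem stub_vl_twoVolumeRate_of_cutoffFreeRate_allU
    (hvol : ∀ β : ℝ, 0 < β → ∀ (U μ : ℝ) (K : TrigPolyC4v),
      ∃ L₀ : ℕ, ∃ D : ℝ, ∃ ρ : ℕ → ℝ, Tendsto ρ atTop (𝓝 0) ∧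
        ∀ (L : ℕ) [NeZero L], L₀ ≤ L → ∀ (L' : ℕ) [NeZero L'], L ≤ L' →
          ∀ (n : ℤ) (k : TorusSite 2 L) (k' : TorusSite 2 L'),
            ‖klSelfEnergyInf L β U μ K n k - klSelfEnergyInf L' β U μ K n k'‖ ≤
              ρ L + D * ∑ i, torusAbs (latticeMomentum L k i - latticeMomentum L' k' i)) :
    ∀ (G : GeoConsts) (P : SplitConsts) (Q : EngConsts) (R : RenConsts), G.WF → P.WF → Q.WF → R.WF →
      ∃ c₅ : ℝ, 0 < c₅ ∧ ∀ c : ℝ, 0 < c → c ≤ c₅ → ∃ U₀ : ℝ, 0 < U₀ ∧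
        ∀ μ ∈ klWindowC, ∀ U : ℝ, 0 < U → U ≤ U₀ → ∀ β : ℝ, klBetaMin ≤ β → β ≤ Real.exp (c / U ^ 2) →
          ∀ K : TrigPolyC4v, klPredsV12.frameOK R U (nScales β) μ K →
            ∀ (Lstar : ℕ) (Mstar : ℕ → ℕ), TowerP klPredsV12 G P Q R β U μ K Lstar Mstar →
              ∃ L₀ : ℕ, ∃ Mth : ℕ → ℕ, ∃ D : ℝ, ∃ ρ : ℕ → ℝ, Tendsto ρ atTop (𝓝 0) ∧
                ∀ (L : ℕ) [NeZero L], L₀ ≤ L → ∀ (M : ℕ) [NeZero M], Mth L ≤ M →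
                  ∀ (L' : ℕ) [NeZero L'], L ≤ L' → ∀ (M' : ℕ) [NeZero M'], Mth L' ≤ M' →
                    ∀ (σ : Fin 2) (ω : MatsubaraIdx M) (ω' : MatsubaraIdx M'), matsubaraInt M ω = matsubaraInt M' ω' →
                      ∀ (k : TorusSite 2 L) (k' : TorusSite 2 L'),
                        ‖klSelfEnergy L M β U μ K klE0 (nScales β + 1) (ω, k) σ -
                            klSelfEnergy L' M' β U μ K klE0 (nScales β + 1) (ω', k') σ‖ ≤
                          ρ L + D * ∑ i, torusAbs (latticeMomentum L k i - latticeMomentum L' k' i) :=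
  stub_vl_twoVolumeRate_of_cutoffFreeRate fun _ _ _ _ _ _ _ _ =>
    ⟨1, one_pos, fun _ _ _ => ⟨1, one_pos, fun μ _ U _ _ β hβmin _ K _ _ _ _ => hvol β (pos_of_klBetaMin_le hβmin) U μ K⟩⟩

/-! ## §2 The bound stub from a bound on the cutoff-free carrier -/

/-- **At one point `(β, U, μ, K)`**: an `L`-uniform bound on `Σ∞^K_L` beyond `L₀` gives own-threshold bounds on the finite-cutoff carrier,
`∃ Mth, ∀ L ≥ max L₀ 3, ∀ M ≥ Mth L, ∀ k σ, ‖Σ̂^K_{L,M}(k,σ)‖ ≤ B + 1` (every `U`, `β > 0`). -/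
theorem uniformBound_of_cutoffFreeBound {β : ℝ} (hβ : 0 < β) (U μ : ℝ) (K : TrigPolyC4v) {B : ℝ} {L₀ : ℕ}
    (hB : ∀ (L : ℕ) [NeZero L], L₀ ≤ L → ∀ (n : ℤ) (p : TorusSite 2 L), ‖klSelfEnergyInf L β U μ K n p‖ ≤ B) :
    ∃ Mth : ℕ → ℕ, ∀ (L : ℕ) [NeZero L], max L₀ 3 ≤ L → ∀ (M : ℕ) [NeZero M], Mth L ≤ M →
      ∀ (k : FreqMomentum L M) (σ : Fin 2), ‖klSelfEnergy L M β U μ K klE0 (nScales β + 1) k σ‖ ≤ B + 1 := by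
  have hper : ∀ L : ℕ, max L₀ 3 ≤ L → ∃ M₁ : ℕ, ∀ M : ℕ, M₁ ≤ M → ∀ (hL0 : NeZero L) (hM0 : NeZero M) (k : FreqMomentum L M) (σ : Fin 2),
      ‖klSelfEnergy L M β U μ K klE0 (nScales β + 1) k σ‖ ≤ B + 1 := by
    intro L hL
    haveI : NeZero L := ⟨by omega⟩
    obtain ⟨M₁, hM₁⟩ := eventually_norm_klSelfEnergy_le_of_inf_bound (le_of_max_le_right hL) hβ U μ K (hB L (le_of_max_le_left hL))
    exact ⟨M₁, fun M hM _ _ k σ => hM₁ M hM k σ⟩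
  obtain ⟨Mth, hMth⟩ := exists_thresholdFn hper
  exact ⟨Mth, fun L _ hL M _ hM k σ => hMth L hL M hM inferInstance inferInstance k σ⟩

/-- **THE DOOR FOR `stub_vl_bound` OF `KLRegimeVolumeLimitV12`, cutoff-free form.**  IF, for every datum of the registered stub, the
CUTOFF-FREE carrier is bounded uniformly in the volume, `∃ B L₀, ∀ L ≥ L₀ ∀ n p, ‖klSelfEnergyInf L β U μ K n p‖ ≤ B`, THEN the registered
`stub_vl_bound` text holds verbatim. -/
theorem stub_vl_bound_of_cutoffFreeBound
    (hbd : ∀ (G : GeoConsts) (P : SplitConsts) (Q : EngConsts) (R : RenConsts), G.WF → P.WF → Q.WF → R.WF →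
      ∃ c₅ : ℝ, 0 < c₅ ∧ ∀ c : ℝ, 0 < c → c ≤ c₅ → ∃ U₀ : ℝ, 0 < U₀ ∧
        ∀ μ ∈ klWindowC, ∀ U : ℝ, 0 < U → U ≤ U₀ → ∀ β : ℝ, klBetaMin ≤ β → β ≤ Real.exp (c / U ^ 2) →
          ∀ K : TrigPolyC4v, klPredsV12.frameOK R U (nScales β) μ K →
            ∀ (Lstar : ℕ) (Mstar : ℕ → ℕ), TowerP klPredsV12 G P Q R β U μ K Lstar Mstar →
              ∃ B : ℝ, ∃ L₀ : ℕ, ∀ (L : ℕ) [NeZero L], L₀ ≤ L → ∀ (n : ℤ) (p : TorusSite 2 L), ‖klSelfEnergyInf L β U μ K n p‖ ≤ B) :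
    ∀ (G : GeoConsts) (P : SplitConsts) (Q : EngConsts) (R : RenConsts), G.WF → P.WF → Q.WF → R.WF →
      ∃ c₅ : ℝ, 0 < c₅ ∧ ∀ c : ℝ, 0 < c → c ≤ c₅ → ∃ U₀ : ℝ, 0 < U₀ ∧
        ∀ μ ∈ klWindowC, ∀ U : ℝ, 0 < U → U ≤ U₀ → ∀ β : ℝ, klBetaMin ≤ β → β ≤ Real.exp (c / U ^ 2) →
          ∀ K : TrigPolyC4v, klPredsV12.frameOK R U (nScales β) μ K →
            ∀ (Lstar : ℕ) (Mstar : ℕ → ℕ), TowerP klPredsV12 G P Q R β U μ K Lstar Mstar →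
              ∃ B : ℝ, ∃ L₀ : ℕ, ∃ Mth : ℕ → ℕ, ∀ (L : ℕ) [NeZero L], L₀ ≤ L → ∀ (M : ℕ) [NeZero M], Mth L ≤ M →
                ∀ (k : FreqMomentum L M) (σ : Fin 2), ‖klSelfEnergy L M β U μ K klE0 (nScales β + 1) k σ‖ ≤ B := by
  intro G P Q R hG hP hQ hR
  obtain ⟨c₅, hc₅, hc⟩ := hbd G P Q R hG hP hQ hR
  refine ⟨c₅, hc₅, fun c hc0 hcc => ?_⟩
  obtain ⟨U₀, hU₀, hU⟩ := hc c hc0 hcc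
  refine ⟨U₀, hU₀, fun μ hμ U hU0 hUU β hβmin hβmax K hK Lstar Mstar hT => ?_⟩
  have hβ : 0 < β := pos_of_klBetaMin_le hβmin
  obtain ⟨B, L₀, hB⟩ := hU μ hμ U hU0 hUU β hβmin hβmax K hK Lstar Mstar hT
  obtain ⟨Mth, hMth⟩ := uniformBound_of_cutoffFreeBound hβ U μ K hB
  exact ⟨B + 1, max L₀ 3, Mth, hMth⟩

/-- **`stub_vl_bound` FROM ONE `L`-UNIFORM BOUND ON THE BARE SIX-POINT COEFFICIENT.**  IF for every `β > 0`, `U`, `μ`: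
`∃ B L₀, ∀ L ≥ L₀ ∀ n p, ‖klSixInf L β U μ n p‖ ≤ B` (the cutoff-free current–current Matsubara coefficient, bounded uniformly in the
volume, the integer label and the momentum), THEN the registered `stub_vl_bound` text holds verbatim (bare frame `Σ∞⁰ = U·occ∞ + U²·Six∞`,
`‖occ∞‖ ≤ 3/2`; all frames by `stub_vl_bound_of_bareFrameBound`). -/
theorem stub_vl_bound_of_sixInf_bound
    (hsix : ∀ β : ℝ, 0 < β → ∀ U μ : ℝ, ∃ B : ℝ, ∃ L₀ : ℕ, ∀ (L : ℕ) [NeZero L], L₀ ≤ L →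
      ∀ (n : ℤ) (p : TorusSite 2 L), ‖klSixInf L β U μ n p‖ ≤ B) :
    ∀ (G : GeoConsts) (P : SplitConsts) (Q : EngConsts) (R : RenConsts), G.WF → P.WF → Q.WF → R.WF →
      ∃ c₅ : ℝ, 0 < c₅ ∧ ∀ c : ℝ, 0 < c → c ≤ c₅ → ∃ U₀ : ℝ, 0 < U₀ ∧
        ∀ μ ∈ klWindowC, ∀ U : ℝ, 0 < U → U ≤ U₀ → ∀ β : ℝ, klBetaMin ≤ β → β ≤ Real.exp (c / U ^ 2) →
          ∀ K : TrigPolyC4v, klPredsV12.frameOK R U (nScales β) μ K →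
            ∀ (Lstar : ℕ) (Mstar : ℕ → ℕ), TowerP klPredsV12 G P Q R β U μ K Lstar Mstar →
              ∃ B : ℝ, ∃ L₀ : ℕ, ∃ Mth : ℕ → ℕ, ∀ (L : ℕ) [NeZero L], L₀ ≤ L → ∀ (M : ℕ) [NeZero M], Mth L ≤ M →
                ∀ (k : FreqMomentum L M) (σ : Fin 2), ‖klSelfEnergy L M β U μ K klE0 (nScales β + 1) k σ‖ ≤ B := by
  refine stub_vl_bound_of_bareFrameBound fun β hβ U μ => ?_
  obtain ⟨B, L₀, hB⟩ := hsix β hβ U μ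
  -- the cutoff-free bare carrier is bounded by `|U|·3/2 + U²·B`
  have hinf : ∀ (L : ℕ) [NeZero L], L₀ ≤ L → ∀ (n : ℤ) (p : TorusSite 2 L),
      ‖klSelfEnergyInf L β U μ 0 n p‖ ≤ |U| * (3 / 2) + U ^ 2 * max B 0 := by
    intro L _ hL n p
    rw [klSelfEnergyInf_zero_frame hβ.ne']
    refine (norm_add_le _ _).trans (add_le_add ?_ ?_)
    · rw [norm_mul, Complex.norm_real, Real.norm_eq_abs]
      exact mul_le_mul_of_nonneg_left (norm_klOccInf_le β U μ) (abs_nonneg U)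
    · rw [norm_mul, norm_pow, Complex.norm_real, Real.norm_eq_abs, sq_abs]
      exact mul_le_mul_of_nonneg_left ((hB L hL n p).trans (le_max_left _ _)) (sq_nonneg U)
  obtain ⟨Mth, hMth⟩ := uniformBound_of_cutoffFreeBound hβ U μ 0 hinf
  exact ⟨|U| * (3 / 2) + U ^ 2 * max B 0 + 1, max L₀ 3, Mth, fun L _ hL M _ hM k => hMth L hL M hM k 0⟩

end Summit.HubbardSuperconductivity.HubbardSuperconductivity.Theorems.TwoPointAssembly

end
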